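import Literature.NumberTheory.Automorphic.GLnCuspidalSpectrumSiegel
import Literature.NumberTheory.Automorphic.AutomorphicFormsGLContinuous
import Mathlib.Analysis.Calculus.InverseFunctionTheorem.ContDiff
import Mathlib.Analysis.Calculus.ContDiff.Bounds
import HarnessLib

/-!
# The archimedean slices `m ↦ η((m, 1) · x)` of a test function on `GL_n(𝔸_K)` are smooth,
compactly supported, with derivatives bounded uniformly for `x` in a compact set
(Garrett, *Modern Analysis of Automorphic Forms by Example* (2018), §7.3, Claim 7.3.9 and the
Schwartz estimate on PDF pp. 340–341; Borel–Jacquet (1979), §4.1)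

A brick of the basic estimate for cusp forms on a Siegel set
(`GLnCuspidalSpectrum.norm_smoothedForm_le_of_isSiegelSetGL`, Garrett Thm. 7.3.10). Garrett's
argument needs, for a test function `φ` and `x` ranging over a compact set, uniform control of the
derivatives of `ν ↦ φ(ω exp(ν) ω')` along the unipotent radical (Claim 7.3.9: these functions
"constitute a *compact* subset of the Schwartz space"; the decay estimate on PDF p. 341 is uniform
over a compact family). Our Poisson-free version of the estimate differentiates the kernel
`m ↦ η((m, 1) · x)` on all of `M_n(K_∞)` (`K_∞ ≅ mixedSpace K = ℝ^{r₁} × ℂ^{r₂}`), and this file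
supplies exactly that regularity from the definition of test functions (`IsTestFunctionGL` of
`GLnCuspidalSpectrumSiegel`: `X ↦ η(g · (exp X, 1))` is `C^∞` for every `g`, plus compact support
and right invariance under a level):

* `leftArchSlice η x m = η((m, 1) · x)` for invertible `m ∈ M_n(K_∞)` and `0` otherwise;
* `IsTestFunctionGL.contDiff_leftArchSlice` — **the slice is `C^∞` on `M_n(K_∞)`**: at an
  invertible point `u₀` it is `Y ↦ η(g₁ · (exp Y, 1))` read in the exponential chart
  `m ↦ log(c⁻¹ u₀⁻¹ m c)` (`c = x_∞`, `g₁ = (u₀, 1) x`; inverse function theorem for `exp` at `0`,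
  as in `ArchimedeanLieDerivSmooth`), and it vanishes near every point outside the compact set
  `{m : (m, 1) ∈ supp η · x⁻¹}`;
* `hasCompactSupport_leftArchSlice` — compact support (`(·, 1) : GL_n(K_∞) →
  GL_n(𝔸_K)` is proper onto the closed subgroup `{g_f = 1}`);
* `IsTestFunctionGL.exists_forall_norm_iteratedFDeriv_leftArchSlice_le` — **uniform bounds**
  `‖D^q (leftArchSlice η x)(m)‖ ≤ B` for all `m` and all `x` in a compact `Ξ`: the slice through
  `x` is the slice through `(1, x_f)` composed with right multiplication by `x_∞`, and by right
  invariance under the level only finitely many `x_f` matter.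

All norms are the scoped `L^∞`-operator norms on matrices (`Matrix.Norms.Operator`), the structure
through which `IsArchSmooth` is defined. Everything here is proved.

## References

* P. Garrett, *Modern Analysis of Automorphic Forms by Example* (2018), §7.3, Claim 7.3.9 and
  PDF pp. 340–341 [Garrett2018].
* A. Borel, H. Jacquet, *Automorphic forms and automorphic representations*, Corvallis (1979),
  §4.1 [BorelJacquet1979].
-/

-- Mathlib idiom (Mathlib/Algebra/Lie/OfAssociative.lean); needed to mention Lie subalgebras of matrix algebras
attribute [local instance 100] LieRing.ofAssociativeRing

noncomputable section

open scoped MatrixGroups Matrix ContDiff Classical Pointwise RestrictedProduct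
open NumberField NumberField.mixedEmbedding IsDedekindDomain Filter Set
open _root_.Topology

namespace Literature.NumberTheory.Automorphic

variable {n : ℕ} {K : Type} [Field K] [NumberField K]

/-! ### Archimedean and finite parts: conjugation formulas and properness -/

/-- Conjugating an archimedean element: `x⁻¹ (w, 1) x = (x_∞⁻¹ w x_∞, 1)`. [folklore] -/
theorem GLn.inv_mul_ofInfinite_mul (x : GL (Fin n) (AdeleRing (𝓞 K) K))
    (w : GL (Fin n) (mixedSpace K)) :
    x⁻¹ * GLn.ofInfinite n K w * x =
      GLn.ofInfinite n K ((GLn.toMixed n K x)⁻¹ * w * GLn.toMixed n K x) := by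
  refine GLn.ext_of_fstHom_of_sndHom ?_ ?_
  · rw [map_mul, map_mul, map_inv, GLn.fstHom_ofInfinite, GLn.fstHom_ofInfinite, map_mul, map_mul,
      map_inv, GLn.toMixed_apply, MulEquiv.symm_apply_apply]
  · rw [map_mul, map_mul, map_inv, GLn.sndHom_ofInfinite, GLn.sndHom_ofInfinite, mul_one,
      inv_mul_cancel]

/-- Conjugating an archimedean element: `θ (w, 1) θ⁻¹ = (θ_∞ w θ_∞⁻¹, 1)`. [folklore] -/
theorem GLn.mul_ofInfinite_mul_inv (θ : GL (Fin n) (AdeleRing (𝓞 K) K))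
    (w : GL (Fin n) (mixedSpace K)) :
    θ * GLn.ofInfinite n K w * θ⁻¹ =
      GLn.ofInfinite n K (GLn.toMixed n K θ * w * (GLn.toMixed n K θ)⁻¹) := by
  have h := GLn.inv_mul_ofInfinite_mul θ⁻¹ w
  rwa [inv_inv, map_inv, inv_inv] at h

/-- Moving an archimedean element past `x`: `(w, 1) x = x (x_∞⁻¹ w x_∞, 1)`. [folklore] -/
theorem GLn.ofInfinite_mul_eq (w : GL (Fin n) (mixedSpace K)) (x : GL (Fin n) (AdeleRing (𝓞 K) K)) :
    GLn.ofInfinite n K w * x = x * GLn.ofInfinite n K ((GLn.toMixed n K x)⁻¹ * w * GLn.toMixed n K x) := by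
  rw [← GLn.inv_mul_ofInfinite_mul, ← mul_assoc, ← mul_assoc, mul_inv_cancel, one_mul]

/-- The archimedean subgroup `{(w, 1)} = {g | g_f = 1}` is the range of `GLn.ofInfinite`. [folklore] -/
theorem GLn.range_ofInfinite_eq :
    Set.range (GLn.ofInfinite n K) = (GLn.sndHom n K) ⁻¹' {1} := by
  ext g
  constructor
  · rintro ⟨w, rfl⟩
    exact GLn.sndHom_ofInfinite w
  · intro hg
    refine ⟨GLn.toMixed n K g, ?_⟩
    have h := GLn.ofInfinite_toMixed_mul_ofFinite_sndHom g
    rw [mem_preimage, mem_singleton_iff] at hg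
    rwa [hg, map_one, mul_one] at h

/-- `GL_n(𝔸_K^∞)` is Hausdorff (units of the Hausdorff ring `M_n(𝔸_K^∞)`). [folklore] -/
theorem t2Space_gl_finiteAdeleRing : T2Space (GL (Fin n) (FiniteAdeleRing (𝓞 K) K)) := by
  haveI : T2Space (FiniteAdeleRing (𝓞 K) K) := inferInstanceAs <| T2Space
    (Πʳ w : HeightOneSpectrum (𝓞 K), [w.adicCompletion K, w.adicCompletionIntegers K])
  infer_instance

/-- The range of `GLn.ofInfinite` is closed in `GL_n(𝔸_K)`. [folklore] -/
theorem GLn.isClosed_range_ofInfinite : IsClosed (Set.range (GLn.ofInfinite n K)) := by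
  haveI := t2Space_gl_finiteAdeleRing (n := n) (K := K)
  rw [GLn.range_ofInfinite_eq]
  exact isClosed_singleton.preimage GLn.continuous_sndHom

/-- **`(·, 1) : GL_n(K_∞) → GL_n(𝔸_K)` is proper**: preimages of compact sets are compact (the
preimage of `C` is the image of the compact `C ∩ {g_f = 1}` under the continuous `g ↦ g_∞`).
[folklore] -/
theorem GLn.isCompact_preimage_ofInfinite {C : Set (GL (Fin n) (AdeleRing (𝓞 K) K))}
    (hC : IsCompact C) : IsCompact (GLn.ofInfinite n K ⁻¹' C) := by
  have heq : GLn.ofInfinite n K ⁻¹' C = GLn.toMixed n K '' (C ∩ Set.range (GLn.ofInfinite n K)) := by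
    ext u
    constructor
    · intro hu
      exact ⟨GLn.ofInfinite n K u, ⟨hu, u, rfl⟩, GLn.toMixed_ofInfinite u⟩
    · rintro ⟨g, ⟨hg, w, rfl⟩, rfl⟩
      rw [mem_preimage, GLn.toMixed_ofInfinite]
      exact hg
  rw [heq]
  exact (hC.inter_right GLn.isClosed_range_ofInfinite).image (GLn.continuous_toMixed n K)

/-! ### The left archimedean slice -/

section Slice

variable (η : GL (Fin n) (AdeleRing (𝓞 K) K) → ℝ) (x : GL (Fin n) (AdeleRing (𝓞 K) K))

/-- The **left archimedean slice** of `η` through `x`: `m ↦ η((m, 1) · x)` for invertible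
`m ∈ M_n(K_∞)` (`K_∞ ≅ mixedSpace K`), extended by `0` to all of `M_n(K_∞)`. [folklore] -/
def leftArchSlice (m : Matrix (Fin n) (Fin n) (mixedSpace K)) : ℝ :=
  if h : IsUnit m then η (GLn.ofInfinite n K h.unit * x) else 0

variable {η x}

/-- The slice at an invertible matrix. [folklore] -/
@[simp]
theorem leftArchSlice_coe (u : GL (Fin n) (mixedSpace K)) :
    leftArchSlice η x (u : Matrix (Fin n) (Fin n) (mixedSpace K)) = η (GLn.ofInfinite n K u * x) := by
  rw [leftArchSlice, dif_pos u.isUnit, IsUnit.unit_of_val_units]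

/-- The slice vanishes at non-invertible matrices. [folklore] -/
theorem leftArchSlice_of_not_isUnit {m : Matrix (Fin n) (Fin n) (mixedSpace K)} (hm : ¬IsUnit m) :
    leftArchSlice η x m = 0 := by
  rw [leftArchSlice, dif_neg hm]

/-- The slice at a unit, in terms of `IsUnit.unit`. [folklore] -/
theorem leftArchSlice_of_isUnit {m : Matrix (Fin n) (Fin n) (mixedSpace K)} (hm : IsUnit m) :
    leftArchSlice η x m = η (GLn.ofInfinite n K hm.unit * x) := by
  rw [leftArchSlice, dif_pos hm]

variable (η x) in
/-- The **archimedean support set** of the slice through `x`: the matrices of the elements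
`w ∈ GL_n(K_∞)` with `(w, 1) · x ∈ supp η`; compact when `η` has compact support. [folklore] -/
def leftArchSupport : Set (Matrix (Fin n) (Fin n) (mixedSpace K)) :=
  Units.val '' (GLn.ofInfinite n K ⁻¹' (tsupport η * {x⁻¹}))

/-- The slice vanishes off the archimedean support set. [folklore] -/
theorem leftArchSlice_eq_zero_of_not_mem {m : Matrix (Fin n) (Fin n) (mixedSpace K)}
    (hm : m ∉ leftArchSupport η x) : leftArchSlice η x m = 0 := by
  by_cases hu : IsUnit m
  · rw [leftArchSlice_of_isUnit hu]
    by_contra hne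
    apply hm
    refine ⟨hu.unit, ?_, hu.unit_spec⟩
    rw [mem_preimage]
    refine ⟨GLn.ofInfinite n K hu.unit * x, subset_tsupport _ (Function.mem_support.2 hne), x⁻¹,
      rfl, ?_⟩
    simp
  · exact leftArchSlice_of_not_isUnit hu

/-- The archimedean support set of a compactly supported `η` is compact. [folklore] -/
theorem isCompact_leftArchSupport (hη : HasCompactSupport η) : IsCompact (leftArchSupport η x) :=
  (GLn.isCompact_preimage_ofInfinite (hη.mul isCompact_singleton)).image Units.continuous_val

end Slice

/-! ### Smoothness of the slices of a test function -/

section Smooth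

variable {η : GL (Fin n) (AdeleRing (𝓞 K) K) → ℝ}

open scoped Matrix.Norms.Operator in
/-- The archimedean support set is closed (compact in the Hausdorff space `M_n(K_∞)`). [folklore] -/
theorem isClosed_leftArchSupport (hη : HasCompactSupport η) (x : GL (Fin n) (AdeleRing (𝓞 K) K)) :
    IsClosed (leftArchSupport η x) :=
  (isCompact_leftArchSupport hη).isClosed

open scoped Matrix.Norms.Operator in
/-- **The slices of a compactly supported function have compact support.** [folklore] -/
theorem hasCompactSupport_leftArchSlice (hη : HasCompactSupport η)
    (x : GL (Fin n) (AdeleRing (𝓞 K) K)) : HasCompactSupport (leftArchSlice η x) := by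
  refine (isCompact_leftArchSupport (x := x) hη).of_isClosed_subset isClosed_closure ?_
  refine closure_minimal (fun m hm => ?_) (isClosed_leftArchSupport hη x)
  by_contra h
  exact hm (leftArchSlice_eq_zero_of_not_mem h)

-- As in `ArchimedeanLieDerivSmooth` / `AutomorphicFormsGLContinuous`: the scoped `L∞`-operator normed
-- ring structure on matrices is only reducibly-defeq to the Pi uniformity, so `CompleteSpace` and the
-- analytic facts about `exp` need this setting.
set_option backward.isDefEq.respectTransparency false in
open scoped Matrix.Norms.Operator in
/-- **The right exponential slices of a test function are smooth on all of `M_n(K_∞)`**: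
`M ↦ η(g · (exp M, 1))` is `C^∞` (this is `IsArchSmooth`, read on `M_n(K_∞)` rather than on the
subtype `↥𝔤𝔩_n`, for the real-valued `η`). [folklore] -/
theorem IsTestFunctionGL.contDiff_expSlice (hη : IsTestFunctionGL n K η)
    (g : GL (Fin n) (AdeleRing (𝓞 K) K)) :
    ContDiff ℝ ∞ fun M : Matrix (Fin n) (Fin n) (mixedSpace K) => η (g * GLn.ofInfinite n K (expGL M)) := by
  letI : LieRing (Matrix (Fin n) (Fin n) (mixedSpace K)) := LieRing.ofAssociativeRing
  have hmem : ∀ M : Matrix (Fin n) (Fin n) (mixedSpace K), M ∈ (archGroupGL n K).lie := fun M =>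
    LieSubalgebra.mem_top M
  let incl : Matrix (Fin n) (Fin n) (mixedSpace K) →ₗ[ℝ] (archGroupGL n K).lie.toSubmodule :=
    LinearMap.codRestrict (archGroupGL n K).lie.toSubmodule LinearMap.id fun M => hmem M
  have hincl : ContDiff ℝ ∞ (incl : Matrix (Fin n) (Fin n) (mixedSpace K) → (archGroupGL n K).lie.toSubmodule) :=
    (⟨incl, incl.continuous_of_finiteDimensional⟩ :
      Matrix (Fin n) (Fin n) (mixedSpace K) →L[ℝ] (archGroupGL n K).lie.toSubmodule).contDiff
  have h := ((hη.isArchSmooth g).comp hincl)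
  have h2 := Complex.reCLM.contDiff.comp h
  convert h2 using 1
  funext M
  simp only [Function.comp_apply, Complex.reCLM_apply, Complex.ofReal_re]
  rfl

set_option backward.isDefEq.respectTransparency false in
open scoped Matrix.Norms.Operator in
/-- **The left archimedean slices of a test function are smooth.** For a test function `η` on
`GL_n(𝔸_K)` and any `x`, the function `m ↦ η((m, 1) · x)` (zero off `GL_n(K_∞)`) is `C^∞` on
`M_n(K_∞)`: near an invertible `u₀` one has `η((m,1) x) = η(g₁ · (exp(log(c⁻¹ u₀⁻¹ m c)), 1))`
with `c = x_∞`, `g₁ = (u₀, 1) x` and `log` the smooth local inverse of `exp` at `0` (inverse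
function theorem), while near a point outside the compact archimedean support set the slice
vanishes identically. (Garrett (2018), §7.3, Claim 7.3.9: smoothness of `ν ↦ φ(ω ν ω')`;
Borel–Jacquet (1979), §4.1.) [folklore] -/
theorem IsTestFunctionGL.contDiff_leftArchSlice (hη : IsTestFunctionGL n K η)
    (x : GL (Fin n) (AdeleRing (𝓞 K) K)) : ContDiff ℝ ∞ (leftArchSlice η x) := by
  -- analytic facts about `exp` on the Banach algebra `M_n(K_∞)`
  have hexp : ContDiff ℝ ∞ (NormedSpace.exp : Matrix (Fin n) (Fin n) (mixedSpace K) →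
      Matrix (Fin n) (Fin n) (mixedSpace K)) :=
    contDiff_iff_contDiffAt.2 fun M => (NormedSpace.exp_analytic (𝕂 := ℝ) M).contDiffAt
  have hexp0 : HasFDerivAt (NormedSpace.exp : Matrix (Fin n) (Fin n) (mixedSpace K) →
      Matrix (Fin n) (Fin n) (mixedSpace K))
      ((ContinuousLinearEquiv.refl ℝ (Matrix (Fin n) (Fin n) (mixedSpace K)) :
        Matrix (Fin n) (Fin n) (mixedSpace K) ≃L[ℝ] Matrix (Fin n) (Fin n) (mixedSpace K)) :
        Matrix (Fin n) (Fin n) (mixedSpace K) →L[ℝ] Matrix (Fin n) (Fin n) (mixedSpace K)) 0 :=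
    (hasFDerivAt_exp_zero (𝕂 := ℝ) (𝔸 := Matrix (Fin n) (Fin n) (mixedSpace K))).congr_fderiv
      (by ext1 M; rfl)
  have hn : (∞ : WithTop ℕ∞) ≠ 0 := by simp
  set log : Matrix (Fin n) (Fin n) (mixedSpace K) → Matrix (Fin n) (Fin n) (mixedSpace K) :=
    hexp.contDiffAt.localInverse hexp0 hn with hlog_def
  have hlog : ContDiffAt ℝ ∞ log 1 := by
    have := hexp.contDiffAt.to_localInverse hexp0 hn
    rwa [NormedSpace.exp_zero] at this
  have hright : ∀ᶠ y in 𝓝 (1 : Matrix (Fin n) (Fin n) (mixedSpace K)), NormedSpace.exp (log y) = y := by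
    have := (hexp.contDiffAt.hasStrictFDerivAt' hexp0 hn).eventually_right_inverse
    rwa [NormedSpace.exp_zero] at this
  refine contDiff_iff_contDiffAt.2 fun m₀ => ?_
  by_cases hT : m₀ ∈ leftArchSupport η x
  · -- `m₀ = u₀` is invertible: exponential chart at `u₀`
    obtain ⟨u₀, -, rfl⟩ := hT
    set c : GL (Fin n) (mixedSpace K) := GLn.toMixed n K x with hc
    set P : Matrix (Fin n) (Fin n) (mixedSpace K) → Matrix (Fin n) (Fin n) (mixedSpace K) :=
      fun m => ((c⁻¹ * u₀⁻¹ : GL (Fin n) (mixedSpace K)) : Matrix (Fin n) (Fin n) (mixedSpace K)) * m *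
        (c : Matrix (Fin n) (Fin n) (mixedSpace K)) with hP_def
    have hP : ContDiff ℝ ∞ P := (contDiff_const.mul contDiff_id).mul contDiff_const
    have hP0 : P (u₀ : Matrix (Fin n) (Fin n) (mixedSpace K)) = 1 := by
      simp only [hP_def]
      rw [← Units.val_mul, ← Units.val_mul, inv_mul_cancel_right, inv_mul_cancel, Units.val_one]
    set g₁ : GL (Fin n) (AdeleRing (𝓞 K) K) := GLn.ofInfinite n K u₀ * x with hg₁
    set Gf : Matrix (Fin n) (Fin n) (mixedSpace K) → ℝ :=
      fun m => η (g₁ * GLn.ofInfinite n K (expGL (log (P m)))) with hGf_def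
    have hGf : ContDiffAt ℝ ∞ Gf (u₀ : Matrix (Fin n) (Fin n) (mixedSpace K)) := by
      have h1 : ContDiffAt ℝ ∞ (fun m => log (P m)) (u₀ : Matrix (Fin n) (Fin n) (mixedSpace K)) := by
        refine ContDiffAt.comp (u₀ : Matrix (Fin n) (Fin n) (mixedSpace K)) ?_ hP.contDiffAt
        rwa [hP0]
      exact (hη.contDiff_expSlice g₁).contDiffAt.comp _ h1
    have hPcont : Tendsto P (𝓝 (u₀ : Matrix (Fin n) (Fin n) (mixedSpace K))) (𝓝 1) := by
      have := hP.continuous.continuousAt (x := (u₀ : Matrix (Fin n) (Fin n) (mixedSpace K)))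
      rwa [ContinuousAt, hP0] at this
    have hunit : ∀ᶠ m in 𝓝 (u₀ : Matrix (Fin n) (Fin n) (mixedSpace K)), IsUnit m :=
      Units.isOpen.mem_nhds u₀.isUnit
    have heq : leftArchSlice η x =ᶠ[𝓝 (u₀ : Matrix (Fin n) (Fin n) (mixedSpace K))] Gf := by
      filter_upwards [hunit, hPcont.eventually hright] with m hm hexpm
      rw [leftArchSlice_of_isUnit hm]
      -- `hm.unit = u₀ c exp(log(P m)) c⁻¹`
      have hval : (hm.unit : Matrix (Fin n) (Fin n) (mixedSpace K)) =
          ((u₀ * c * expGL (log (P m)) * c⁻¹ : GL (Fin n) (mixedSpace K)) :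
            Matrix (Fin n) (Fin n) (mixedSpace K)) := by
        rw [IsUnit.unit_spec,
          show ((u₀ * c * expGL (log (P m)) * c⁻¹ : GL (Fin n) (mixedSpace K)) :
              Matrix (Fin n) (Fin n) (mixedSpace K)) =
            ((u₀ * c : GL (Fin n) (mixedSpace K)) : Matrix (Fin n) (Fin n) (mixedSpace K)) *
              NormedSpace.exp (log (P m)) *
              ((c⁻¹ : GL (Fin n) (mixedSpace K)) : Matrix (Fin n) (Fin n) (mixedSpace K)) from rfl,
          hexpm, hP_def]
        dsimp only
        rw [show ((u₀ * c : GL (Fin n) (mixedSpace K)) : Matrix (Fin n) (Fin n) (mixedSpace K)) *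
              (((c⁻¹ * u₀⁻¹ : GL (Fin n) (mixedSpace K)) : Matrix (Fin n) (Fin n) (mixedSpace K)) * m *
                (c : Matrix (Fin n) (Fin n) (mixedSpace K))) *
              ((c⁻¹ : GL (Fin n) (mixedSpace K)) : Matrix (Fin n) (Fin n) (mixedSpace K)) =
            ((u₀ * c : GL (Fin n) (mixedSpace K)) : Matrix (Fin n) (Fin n) (mixedSpace K)) *
              ((c⁻¹ * u₀⁻¹ : GL (Fin n) (mixedSpace K)) : Matrix (Fin n) (Fin n) (mixedSpace K)) * m *
              ((c : Matrix (Fin n) (Fin n) (mixedSpace K)) *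
                ((c⁻¹ : GL (Fin n) (mixedSpace K)) : Matrix (Fin n) (Fin n) (mixedSpace K))) by
            noncomm_ring,
          ← Units.val_mul, ← Units.val_mul, show u₀ * c * (c⁻¹ * u₀⁻¹) = 1 by group, mul_inv_cancel,
          Units.val_one, one_mul, mul_one]
      have hunit_eq : hm.unit = u₀ * c * expGL (log (P m)) * c⁻¹ := Units.ext hval
      -- `(u₀ c e c⁻¹, 1) x = (u₀, 1) x (e, 1)`
      have hG : GLn.ofInfinite n K (u₀ * c * expGL (log (P m)) * c⁻¹) * x =
          g₁ * GLn.ofInfinite n K (expGL (log (P m))) := by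
        have h1 : u₀ * c * expGL (log (P m)) * c⁻¹ = u₀ * (c * expGL (log (P m)) * c⁻¹) := by group
        have h2 : (GLn.toMixed n K x)⁻¹ * (c * expGL (log (P m)) * c⁻¹) * GLn.toMixed n K x =
            expGL (log (P m)) := by
          rw [hc]; group
        rw [h1, map_mul, mul_assoc, GLn.ofInfinite_mul_eq (c * expGL (log (P m)) * c⁻¹) x, h2, hg₁,
          mul_assoc]
      rw [hunit_eq, hG]
    exact hGf.congr_of_eventuallyEq heq
  · -- off the archimedean support the slice vanishes identically
    have hopen : (leftArchSupport η x)ᶜ ∈ 𝓝 m₀ :=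
      (isClosed_leftArchSupport hη.hasCompactSupport x).isOpen_compl.mem_nhds hT
    have heq : leftArchSlice η x =ᶠ[𝓝 m₀] fun _ => 0 := by
      filter_upwards [hopen] with m hm
      exact leftArchSlice_eq_zero_of_not_mem hm
    exact (contDiffAt_const (c := (0 : ℝ))).congr_of_eventuallyEq heq

end Smooth

/-! ### Uniform bounds on compact sets -/

section Uniform

variable {η : GL (Fin n) (AdeleRing (𝓞 K) K) → ℝ}

/-- **Factorisation through `(1, x_f)`**: the slice through `x` is the slice through `(1, x_f)`
composed with right multiplication by `x_∞` (`(m, 1) x = (m x_∞, 1) (1, x_f)`). [folklore] -/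
theorem leftArchSlice_eq_comp_mul_right (x : GL (Fin n) (AdeleRing (𝓞 K) K)) :
    leftArchSlice η x = fun m => leftArchSlice η (GLn.ofFinite n K (GLn.sndHom n K x))
      (m * (GLn.toMixed n K x : Matrix (Fin n) (Fin n) (mixedSpace K))) := by
  funext m
  by_cases hm : IsUnit m
  · obtain ⟨u, rfl⟩ := hm
    rw [← Units.val_mul, leftArchSlice_coe, leftArchSlice_coe, map_mul, mul_assoc,
      GLn.ofInfinite_toMixed_mul_ofFinite_sndHom]
  · have hm' : ¬IsUnit (m * (GLn.toMixed n K x : Matrix (Fin n) (Fin n) (mixedSpace K))) := by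
      intro h
      apply hm
      have := h.mul (GLn.toMixed n K x)⁻¹.isUnit
      rwa [mul_assoc, ← Units.val_mul, mul_inv_cancel, Units.val_one, mul_one] at this
    rw [leftArchSlice_of_not_isUnit hm, leftArchSlice_of_not_isUnit hm']

/-- **Level invariance of the slices**: for `η` right invariant under `{1} × U₀`, the slice through
`(1, h u)` equals the slice through `(1, h)` for `u ∈ U₀`. [folklore] -/
theorem leftArchSlice_ofFinite_mul {U₀ : Subgroup (GL (Fin n) (FiniteAdeleRing (𝓞 K) K))}
    (hinv : ∀ u ∈ U₀.map (GLn.ofFinite n K), ∀ g, η (g * u) = η g)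
    (h : GL (Fin n) (FiniteAdeleRing (𝓞 K) K)) {u : GL (Fin n) (FiniteAdeleRing (𝓞 K) K)}
    (hu : u ∈ U₀) :
    leftArchSlice η (GLn.ofFinite n K (h * u)) = leftArchSlice η (GLn.ofFinite n K h) := by
  funext m
  by_cases hm : IsUnit m
  · rw [leftArchSlice_of_isUnit hm, leftArchSlice_of_isUnit hm, map_mul, ← mul_assoc]
    exact hinv _ (Subgroup.mem_map_of_mem _ hu) _
  · rw [leftArchSlice_of_not_isUnit hm, leftArchSlice_of_not_isUnit hm]

set_option backward.isDefEq.respectTransparency false in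
open scoped Matrix.Norms.Operator in
/-- Right multiplication by a fixed matrix as a continuous linear map of `M_n(K_∞)`, with operator
norm at most the norm of the matrix. [folklore] -/
theorem exists_clm_mul_right (c : Matrix (Fin n) (Fin n) (mixedSpace K)) :
    ∃ R : Matrix (Fin n) (Fin n) (mixedSpace K) →L[ℝ] Matrix (Fin n) (Fin n) (mixedSpace K),
      (∀ m, R m = m * c) ∧ ‖R‖ ≤ ‖c‖ := by
  refine ⟨LinearMap.toContinuousLinearMap (LinearMap.mulRight ℝ c), fun m => rfl, ?_⟩
  refine ContinuousLinearMap.opNorm_le_bound _ (norm_nonneg c) fun m => ?_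
  change ‖m * c‖ ≤ ‖c‖ * ‖m‖
  rw [mul_comm ‖c‖]
  exact norm_mul_le m c

set_option backward.isDefEq.respectTransparency false in
open scoped Matrix.Norms.Operator in
/-- **Uniform bounds for the derivatives of the slices on compact sets.** For a test function `η`,
a compact `Ξ ⊆ GL_n(𝔸_K)` and `q ∈ ℕ` there is `B` with `‖D^q (leftArchSlice η x)(m)‖ ≤ B` for all
`x ∈ Ξ` and all `m ∈ M_n(K_∞)`. Proof: the slice through `x` is the slice through `(1, x_f)`
precomposed with right multiplication by `x_∞` (operator norm `≤ ‖x_∞‖`, bounded on `Ξ`); by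
right invariance under the level `{1} × U₀` the slice through `(1, x_f)` only depends on the coset
`x_f U₀`, and the compact set of finite parts of `Ξ` meets finitely many cosets; each of the
finitely many slices is `C^∞` with compact support, so its `q`-th derivative is bounded. (Garrett
(2018), §7.3: uniformity of the Schwartz estimates over a compact family, PDF pp. 340–341.)
[folklore] -/
theorem IsTestFunctionGL.exists_forall_norm_iteratedFDeriv_leftArchSlice_le
    (hη : IsTestFunctionGL n K η) {Ξ : Set (GL (Fin n) (AdeleRing (𝓞 K) K))} (hΞ : IsCompact Ξ)
    (q : ℕ) :
    ∃ B : ℝ, ∀ x ∈ Ξ, ∀ m, ‖iteratedFDeriv ℝ q (leftArchSlice η x) m‖ ≤ B := by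
  obtain ⟨U, ⟨U₀, hU₀o, -, rfl⟩, hinv⟩ := hη.exists_level
  -- finitely many cosets of `U₀` cover the finite parts of `Ξ`
  have hF : IsCompact (GLn.sndHom n K '' Ξ) := hΞ.image GLn.continuous_sndHom
  have hcover : GLn.sndHom n K '' Ξ ⊆ ⋃ h : GL (Fin n) (FiniteAdeleRing (𝓞 K) K),
      (fun u => h * u) '' (U₀ : Set (GL (Fin n) (FiniteAdeleRing (𝓞 K) K))) := by
    intro h _
    exact mem_iUnion.2 ⟨h, 1, U₀.one_mem, mul_one h⟩
  have hopen : ∀ h : GL (Fin n) (FiniteAdeleRing (𝓞 K) K),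
      IsOpen ((fun u => h * u) '' (U₀ : Set (GL (Fin n) (FiniteAdeleRing (𝓞 K) K)))) := fun h =>
    (isOpenMap_mul_left h) _ hU₀o
  obtain ⟨s, hs⟩ := hF.elim_finite_subcover _ hopen hcover
  -- a bound for the finitely many slices through `(1, h)`, `h ∈ s`
  have hbd : ∀ h : GL (Fin n) (FiniteAdeleRing (𝓞 K) K), ∃ C : ℝ, 0 ≤ C ∧
      ∀ m, ‖iteratedFDeriv ℝ q (leftArchSlice η (GLn.ofFinite n K h)) m‖ ≤ C := by
    intro h
    have hcd := hη.contDiff_leftArchSlice (GLn.ofFinite n K h)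
    have hcs := hasCompactSupport_leftArchSlice hη.hasCompactSupport (GLn.ofFinite n K h)
    have hcont : Continuous (iteratedFDeriv ℝ q (leftArchSlice η (GLn.ofFinite n K h))) :=
      hcd.continuous_iteratedFDeriv (by exact_mod_cast le_top)
    obtain ⟨C, hC⟩ := hcont.bounded_above_of_compact_support (hcs.iteratedFDeriv q)
    exact ⟨max C 0, le_max_right _ _, fun m => (hC m).trans (le_max_left _ _)⟩
  choose C hC0 hC using hbd
  -- a bound for `‖x_∞‖` on `Ξ`
  obtain ⟨D, hD⟩ : ∃ D : ℝ, ∀ x ∈ Ξ, ‖(GLn.toMixed n K x : Matrix (Fin n) (Fin n) (mixedSpace K))‖ ≤ D := by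
    have hc : Continuous fun x : GL (Fin n) (AdeleRing (𝓞 K) K) =>
        ‖(GLn.toMixed n K x : Matrix (Fin n) (Fin n) (mixedSpace K))‖ :=
      (Units.continuous_val.comp (GLn.continuous_toMixed n K)).norm
    obtain ⟨D, hD⟩ := (hΞ.image hc).isBounded.subset_closedBall 0 |>.imp fun D hD => hD
    · exact ⟨D, fun x hx => by
        have := hD ⟨x, hx, rfl⟩
        rwa [Metric.mem_closedBall, dist_zero_right, Real.norm_of_nonneg (norm_nonneg _)] at this⟩
  have hD0 : ∀ x ∈ Ξ, 0 ≤ D := fun x hx => (norm_nonneg _).trans (hD x hx)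
  refine ⟨(∑ h ∈ s, C h) * (max D 0) ^ q, fun x hx m => ?_⟩
  -- `x_f ∈ h U₀` for some `h ∈ s`
  obtain ⟨h, hhs, u, hu, hxu⟩ : ∃ h ∈ s, ∃ u ∈ U₀, h * u = GLn.sndHom n K x := by
    have := hs ⟨x, hx, rfl⟩
    obtain ⟨h, hh, hmem⟩ := mem_iUnion₂.1 this
    obtain ⟨u, hu, hxu⟩ := hmem
    exact ⟨h, hh, u, hu, hxu⟩
  -- factor the slice
  obtain ⟨R, hR, hRn⟩ := exists_clm_mul_right (GLn.toMixed n K x : Matrix (Fin n) (Fin n) (mixedSpace K))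
  have hfac : leftArchSlice η x = (leftArchSlice η (GLn.ofFinite n K h)) ∘ R := by
    rw [leftArchSlice_eq_comp_mul_right x, ← hxu, leftArchSlice_ofFinite_mul hinv h hu]
    funext m
    rw [Function.comp_apply, hR]
  have hcd : ContDiff ℝ ∞ (leftArchSlice η (GLn.ofFinite n K h)) :=
    hη.contDiff_leftArchSlice (GLn.ofFinite n K h)
  rw [hfac, R.iteratedFDeriv_comp_right hcd m (by exact_mod_cast le_top)]
  calc ‖(iteratedFDeriv ℝ q (leftArchSlice η (GLn.ofFinite n K h)) (R m)).compContinuousLinearMap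
          fun _ => R‖
      ≤ ‖iteratedFDeriv ℝ q (leftArchSlice η (GLn.ofFinite n K h)) (R m)‖ * ∏ _i : Fin q, ‖R‖ :=
        ContinuousMultilinearMap.norm_compContinuousLinearMap_le _ _
    _ ≤ C h * (max D 0) ^ q := by
        rw [Finset.prod_const, Finset.card_univ, Fintype.card_fin]
        refine mul_le_mul (hC h _) ?_ (pow_nonneg (norm_nonneg _) _) (hC0 h)
        exact pow_le_pow_left₀ (norm_nonneg _) ((hRn.trans (hD x hx)).trans (le_max_left _ _)) q
    _ ≤ (∑ h' ∈ s, C h') * (max D 0) ^ q := by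
        refine mul_le_mul_of_nonneg_right ?_ (pow_nonneg (le_max_right _ _) _)
        exact Finset.single_le_sum (fun h' _ => hC0 h') hhs

end Uniform

end Literature.NumberTheory.Automorphic
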